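import Summits.CriticalPhenomena.PercolationContinuityZ3.Theorems.PercNearOneGluingNoHeavyQuantFarTreeRowContraction
import Summits.CriticalPhenomena.PercolationContinuityZ3.Theorems.PercNearOneGluingNoHeavyQuantFarRelayRowStar
import Summits.CriticalPhenomena.PercolationContinuityZ3.Theorems.PercNearOneGluingNoHeavyQuantFarTreeHubBlocks
import Literature.Probability.LatticeModels.ProdBernoulliBlocks
import HarnessLib

/-!
# QUANT lane R8, FAR on trees: block-combs in the bare-leaf cell — ESSENTIAL form (glued blocks as weight-one paths, shared sure vertices)

builds on p205010 (kernel theorem, internal audit signed; external expert review pending)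

Support file (`--supports stmt-CriticalPhenomena-4575`), QUANT lane seat prim-quant-p1 (gen 7); memo `run/shared/lean/prim/quant/P1-SURPLUS.md`
§18.  Companion of `…QuantFarTreeBlockCombBareLeaf.lean` (same seat, `Quant.farTree_blockComb_bareLeaf`: private parts `P b ∖ P a` pairwise
EQUAL or disjoint).  In the `par`/`depth` coordinates of `Quant.tree_ancestor_axioms` a glued block is a PATH of weight-one gates, so the
private parts of its relays are NESTED, not equal, and distinct hairs may share sure vertices; the right invariant is the ESSENTIAL private part
`E b = {y ∈ P b ∖ P a | q y ≠ 1}`.  This file re-proves the cell theorem with `E b` in place of `P b ∖ P a` (same architecture: force the sure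
gates open with `Quant.prodBernoulli_real_eq_union_of_gate_one`, read the light event through independent blocks —
`Literature…prodBernoulli_real_preimage_readBlocks` — apply `Quant.IndepBlob.prodBernoulli_far_indepBlob`, and contract the strict ancestors of
`a` one at a time with `Quant.farTree_light_le_of_contract`; the essential parts are invariant under these contractions).
Theorems only; no definitions, no sorries, standard axioms.

* `Quant.farTree_blockComb_cell_base` — chain above `a` sure ⟹ `P(light) ≤ 1 − q a`.
* `Quant.farTree_blockComb_cell_aux` — induction on the non-sure strict ancestors of `a`.
* `Quant.farTree_blockComb_cell` — **FAR at EVERY layer: `x ∈ P x`; relays `b ∋ a`-below glued (`P b ∖ P a` sure); essential private parts of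
  the other relays pairwise equal or disjoint; bare leaf `q a ≤ ∏_{P b ∖ P a} q`; then `2j < Σ_b ∏_{P b} q`, `1 − ∏_{P a} q ≤ t` ⟹
  `P(#{b ∈ A | P b open} ≤ j) ≤ t`.**  Families covered (in the cell): root blocks + combs of any depth, blob hairs at any level, spine relays,
  'hub + leaves + root blocks' with blocks heavier than the bare leaf.  Honest scope: a CELL theorem; the light cell is [MTL]'s open residue.
[cite: KozmaNitzan2024, Lemma 2 (p. 6), Conjecture 3 (p. 15)] (the gluing rows `Quant.FarTreeRow` serves); the family theorem is [this work].
-/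

noncomputable section

namespace Summit.CriticalPhenomena.PercolationContinuityZ3.Theorems

namespace Quant

open Finset MeasureTheory
open Literature.Probability.LatticeModels
open Literature.Probability.Percolation
open scoped Classical

variable {m : ℕ}

/-- **Base case: the chain above `a` is sure.**  With every strict member of `P a` of gate `1`, glued relays below `a`, ESSENTIAL private
parts (the non-sure gates of `P b ∖ P a`) pairwise equal or disjoint and the bare-leaf condition, `2j < Σ_b ∏_{P b} q` implies
`P(#{b ∈ A | P b open} ≤ j) ≤ 1 − q a` (independent blocks + `Quant.IndepBlob.prodBernoulli_far_indepBlob`). [this work] -/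
theorem farTree_blockComb_cell_base (P : Fin m → Finset (Fin m)) (hrefl : ∀ x, x ∈ P x)
    (q : Fin m → unitInterval) (A : Finset (Fin m)) (j : ℕ) (a : Fin m) (haA : a ∈ A)
    (hchain : ∀ y ∈ P a, y ≠ a → q y = 1)
    (hglue : ∀ b ∈ A, a ∈ P b → ∀ y ∈ P b, y ∉ P a → q y = 1)
    (hshape : ∀ b ∈ A, ∀ b' ∈ A, a ∉ P b → a ∉ P b' →
      (P b \ P a).filter (fun y => q y ≠ 1) = (P b' \ P a).filter (fun y => q y ≠ 1) ∨
        Disjoint ((P b \ P a).filter fun y => q y ≠ 1) ((P b' \ P a).filter fun y => q y ≠ 1))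
    (hbare : ∀ b ∈ A, a ∉ P b → (q a : ℝ) ≤ ∏ y ∈ P b \ P a, (q y : ℝ))
    (hEN : (2 * j : ℝ) < ∑ b ∈ A, ∏ y ∈ P b, (q y : ℝ)) :
    (prodBernoulli q).real
        {ω : Set (Fin m) | (A.filter fun b => ((P b : Finset (Fin m)) : Set (Fin m)) ⊆ ω).card ≤ j} ≤ 1 - (q a : ℝ) := by
  set μ := prodBernoulli q with hμ
  have hq0 : ∀ y, (0 : ℝ) ≤ q y := fun y => (q y).2.1; have hq1 : ∀ y, (q y : ℝ) ≤ 1 := fun y => (q y).2.2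
  set L : Set (Set (Fin m)) :=
    {ω : Set (Fin m) | (A.filter fun b => ((P b : Finset (Fin m)) : Set (Fin m)) ⊆ ω).card ≤ j} with hL
  set G : Fin m → Finset (Fin m) := fun b => (P b \ P a).filter fun y => q y ≠ 1 with hG
  have hGsub : ∀ b, G b ⊆ P b := fun b => (Finset.filter_subset _ _).trans Finset.sdiff_subset
  have hGmem : ∀ b y, y ∈ G b ↔ y ∈ P b ∧ y ∉ P a ∧ q y ≠ 1 := fun b y => by
    simp only [hG, Finset.mem_filter, Finset.mem_sdiff, and_assoc]
  have haG : ∀ b, a ∉ G b := fun b h => ((hGmem b a).1 h).2.1 (hrefl a)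
  set T : Finset (Fin m) := Finset.univ.filter fun y => q y = 1 with hT
  have hT1 : ∀ y ∈ T, q y = 1 := fun y hy => (Finset.mem_filter.1 hy).2
  have hTmem : ∀ y, q y = 1 → y ∈ T := fun y hy => Finset.mem_filter.2 ⟨Finset.mem_univ _, hy⟩
  have hsure : ∀ b ∈ A, a ∉ P b → ∀ y ∈ P b, y ∉ G b → q y = 1 := by
    intro b hb hab y hy hyG
    by_contra hq
    by_cases hyPa : y ∈ P a
    · exact hq (hchain y hyPa (fun hya => hab (hya ▸ hy)))
    · exact hyG ((hGmem b y).2 ⟨hy, hyPa, hq⟩)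
  set blk : Fin m → Fin m := fun y =>
    if h : ∃ b, b ∈ A ∧ a ∉ P b ∧ y ∈ G b then (G (Classical.choose h)).min' ⟨y, (Classical.choose_spec h).2.2⟩ else y
    with hblk
  set rel : Fin m → Prop := fun y => y = a ∨ ∃ b, b ∈ A ∧ a ∉ P b ∧ y ∈ G b with hrel
  set g : Fin m → Set (Fin m) → Prop := fun k ω => ∀ e, blk e = k → rel e → e ∈ ω with hg
  have hnot_a : ¬ ∃ b, b ∈ A ∧ a ∉ P b ∧ a ∈ G b := fun ⟨b, _, _, h⟩ => haG b h
  have hblk_a : blk a = a := by simp only [hblk, dif_neg hnot_a]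
  have hclass : ∀ b ∈ A, ∀ b' ∈ A, a ∉ P b → a ∉ P b' → ∀ y, y ∈ G b → y ∈ G b' → G b = G b' := by
    intro b hb b' hb' hab hab' y hy hy'
    rcases hshape b hb b' hb' hab hab' with h | h
    · exact h
    · exact absurd (Finset.disjoint_left.1 h hy) (not_not.2 hy')
  have hblk_G : ∀ b ∈ A, a ∉ P b → ∀ y (hy : y ∈ G b), blk y = (G b).min' ⟨y, hy⟩ := by
    intro b hb hab y hy
    have hex : ∃ b, b ∈ A ∧ a ∉ P b ∧ y ∈ G b := ⟨b, hb, hab, hy⟩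
    simp only [hblk, dif_pos hex]
    have hspec := Classical.choose_spec hex
    have heq : G (Classical.choose hex) = G b :=
      hclass _ hspec.1 b hb hspec.2.1 hab y hspec.2.2 hy
    simp only [heq]
  have hmin_mem : ∀ b (h : (G b).Nonempty), (G b).min' h ∈ G b := fun b h => Finset.min'_mem _ _
  have hg_a : ∀ ω, g a ω ↔ a ∈ ω := by
    intro ω
    refine ⟨fun h => h a hblk_a (Or.inl rfl), fun ha e hbe hre => ?_⟩
    rcases hre with rfl | ⟨b, hb, hab, heG⟩
    · exact ha
    · exfalso
      rw [hblk_G b hb hab e heG] at hbe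
      exact haG b (hbe ▸ hmin_mem b ⟨e, heG⟩)
  have hg_G : ∀ b ∈ A, a ∉ P b → ∀ (hne : (G b).Nonempty) ω, g ((G b).min' hne) ω ↔ ((G b : Finset (Fin m)) : Set (Fin m)) ⊆ ω := by
    intro b hb hab hne ω
    constructor
    · intro h y hy
      exact h y (hblk_G b hb hab y hy) (Or.inr ⟨b, hb, hab, hy⟩)
    · intro hsub e hbe hre
      rcases hre with rfl | ⟨b', hb', hab', heG'⟩
      · exfalso
        rw [hblk_a] at hbe
        exact haG b (hbe.symm ▸ hmin_mem b hne)
      · rw [hblk_G b' hb' hab' e heG'] at hbe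
        have hr : (G b').min' ⟨e, heG'⟩ ∈ G b := hbe ▸ hmin_mem b hne
        have heq : G b' = G b := hclass b' hb' b hb hab' hab _ (hmin_mem b' ⟨e, heG'⟩) hr
        exact hsub (Finset.mem_coe.2 (heq ▸ heG'))
  have hg_other : ∀ k, k ≠ a → (¬ ∃ b, b ∈ A ∧ a ∉ P b ∧ ∃ hne : (G b).Nonempty, (G b).min' hne = k) → ∀ ω, g k ω := by
    intro k hka hk ω e hbe hre
    exfalso
    rcases hre with rfl | ⟨b, hb, hab, heG⟩
    · exact hka (hblk_a ▸ hbe).symm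
    · rw [hblk_G b hb hab e heG] at hbe
      exact hk ⟨b, hb, hab, ⟨e, heG⟩, hbe⟩
  have hnot_rep : ∀ k, q k = 1 → ¬ ∃ b, b ∈ A ∧ a ∉ P b ∧ ∃ hne : (G b).Nonempty, (G b).min' hne = k := by
    rintro k hk ⟨b, hb, hab, hne, hbeq⟩
    have hr := hmin_mem b hne
    rw [hbeq] at hr
    exact ((hGmem b k).1 hr).2.2 hk
  set q' : Fin m → unitInterval := fun k => ⟨μ.real {ω | g k ω}, measureReal_nonneg, measureReal_le_one⟩ with hq'
  have hq'val : ∀ k, ((q' k : unitInterval) : ℝ) = μ.real {ω | g k ω} := fun k => rfl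
  have hq'a : ((q' a : unitInterval) : ℝ) = q a := by
    rw [hq'val]
    have : {ω : Set (Fin m) | g a ω} = {ω | a ∈ ω} := Set.ext fun ω => hg_a ω
    rw [this, hμ, prodBernoulli_real_setOf_mem]
  have hq'G : ∀ b ∈ A, a ∉ P b → ∀ (hne : (G b).Nonempty),
      ((q' ((G b).min' hne) : unitInterval) : ℝ) = ∏ y ∈ G b, (q y : ℝ) := by
    intro b hb hab hne
    rw [hq'val]
    have : {ω : Set (Fin m) | g ((G b).min' hne) ω} = {ω | ((G b : Finset (Fin m)) : Set (Fin m)) ⊆ ω} :=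
      Set.ext fun ω => hg_G b hb hab hne ω
    rw [this, hμ, prodBernoulli_real_subset]
  have hq'other : ∀ k, k ≠ a → (¬ ∃ b, b ∈ A ∧ a ∉ P b ∧ ∃ hne : (G b).Nonempty, (G b).min' hne = k) →
      ((q' k : unitInterval) : ℝ) = 1 := by
    intro k hka hk
    rw [hq'val]
    have : {ω : Set (Fin m) | g k ω} = Set.univ := Set.eq_univ_of_forall fun ω => hg_other k hka hk ω
    rw [this, probReal_univ]
  have hprodG : ∀ b, ∏ y ∈ G b, (q y : ℝ) = ∏ y ∈ P b \ P a, (q y : ℝ) := by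
    intro b
    simp only [hG]
    refine Finset.prod_filter_of_ne fun y _ hy h1 => hy ?_
    rw [h1]; rfl
  have hy : ∀ k, q' a ≤ q' k := by
    intro k
    show ((q' a : unitInterval) : ℝ) ≤ q' k
    rw [hq'a]
    by_cases hka : k = a
    · rw [hka, hq'a]
    by_cases hk : ∃ b, b ∈ A ∧ a ∉ P b ∧ ∃ hne : (G b).Nonempty, (G b).min' hne = k
    · obtain ⟨b, hb, hab, hne, rfl⟩ := hk
      rw [hq'G b hb hab hne, hprodG b]
      exact hbare b hb hab
    · rw [hq'other k hka hk]; exact hq1 a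
  set key : Fin m → Fin m := fun b =>
    if a ∈ P b then a else if hne : (G b).Nonempty then (G b).min' hne else b with hkey
  set c : Fin m → ℝ := fun k => ((A.filter fun b => key b = k).card : ℝ) with hc
  have hc0 : ∀ k, 0 ≤ c k := fun k => Nat.cast_nonneg _
  have hqb1 : ∀ b ∈ A, a ∉ P b → ¬ (G b).Nonempty → q b = 1 := fun b hb hab hne => hsure b hb hab b (hrefl b) (fun h => hne ⟨b, h⟩)
  have hkey_ge : ∀ b ∈ A, ∏ y ∈ P b, (q y : ℝ) ≤ ((q' (key b) : unitInterval) : ℝ) := by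
    intro b hb
    by_cases hab : a ∈ P b
    · simp only [hkey, if_pos hab]
      rw [hq'a, ← Finset.mul_prod_erase _ _ hab]
      have : ∏ y ∈ (P b).erase a, (q y : ℝ) ≤ 1 := Finset.prod_le_one (fun y _ => hq0 y) fun y _ => hq1 y
      calc (q a : ℝ) * ∏ y ∈ (P b).erase a, (q y : ℝ) ≤ (q a : ℝ) * 1 := mul_le_mul_of_nonneg_left this (hq0 a)
        _ = q a := mul_one _
    · by_cases hne : (G b).Nonempty
      · simp only [hkey, if_neg hab, dif_pos hne]
        rw [hq'G b hb hab hne]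
        exact Finset.prod_le_prod_of_subset_of_le_one (hGsub b) (fun y _ => hq0 y) fun y _ _ => hq1 y
      · simp only [hkey, if_neg hab, dif_neg hne]
        have hba : b ≠ a := fun h => hab (h ▸ hrefl a)
        rw [hq'other b hba (hnot_rep b (hqb1 b hb hab hne))]
        exact Finset.prod_le_one (fun y _ => hq0 y) fun y _ => hq1 y
  have hEN' : (2 * (j : ℝ) : ℝ) < ∑ k, c k * ((q' k : unitInterval) : ℝ) := by
    have hsum : ∑ k, c k * ((q' k : unitInterval) : ℝ) = ∑ b ∈ A, ((q' (key b) : unitInterval) : ℝ) := by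
      rw [← Finset.sum_fiberwise A key (fun b => ((q' (key b) : unitInterval) : ℝ))]
      refine Finset.sum_congr rfl fun k _ => ?_
      have hin : ∑ b ∈ A with key b = k, ((q' (key b) : unitInterval) : ℝ) =
          ∑ b ∈ A with key b = k, ((q' k : unitInterval) : ℝ) :=
        Finset.sum_congr rfl fun b hb => by rw [(Finset.mem_filter.1 hb).2]
      rw [hin, Finset.sum_const, nsmul_eq_mul]
    rw [hsum]
    exact lt_of_lt_of_le hEN (Finset.sum_le_sum fun b hb => hkey_ge b hb)
  set S : Set (Set (Fin m)) := {W : Set (Fin m) | ∑ k ∈ (Finset.univ : Finset (Fin m)).filter (fun k => k ∈ W), c k ≤ (j : ℝ)}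
    with hS
  have hfar : (prodBernoulli q').real S ≤ 1 - ((q' a : unitInterval) : ℝ) :=
    IndepBlob.prodBernoulli_far_indepBlob q' c hc0 a hy (j : ℝ) hEN'
  have hloc : IsBlockLocal blk g := by
    intro k ω ω' hωω'
    simp only [hg]
    exact forall_congr' fun e => imp_congr_right fun hbe => imp_congr_right fun _ => hωω' e hbe
  have hmeas : ∀ k, Measurable (g k) := fun k => Measurable.of_discrete
  set R : Set (Fin m) → Set (Fin m) := fun ω => {k | g k ω} with hR
  set S' : Set (Set (Fin m)) :=
    {ω' : Set (Fin m) | ∑ k ∈ (Finset.univ : Finset (Fin m)).filter (fun k => g k ω'), c k ≤ (j : ℝ)} with hS'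
  have hSS : R ⁻¹' S = S' := by
    ext ω'
    simp only [Set.mem_preimage, hS, hS', Set.mem_setOf_eq, hR]
  have hpre : μ.real S' = (prodBernoulli q').real S := by
    rw [← hSS, hμ]
    exact prodBernoulli_real_preimage_readBlocks q blk hloc hmeas q' (fun k => rfl) MeasurableSet.of_discrete
  have hcount : ∀ ω : Set (Fin m), (↑T : Set (Fin m)) ⊆ ω →
      ((A.filter fun b => ((P b : Finset (Fin m)) : Set (Fin m)) ⊆ ω).card : ℝ) =
        ∑ k ∈ (Finset.univ : Finset (Fin m)).filter (fun k => g k ω), c k := by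
    intro ω hTω
    have hTω' : ∀ y, q y = 1 → y ∈ ω := fun y hy => hTω (Finset.mem_coe.2 (hTmem y hy))
    have hiff : ∀ b ∈ A, (((P b : Finset (Fin m)) : Set (Fin m)) ⊆ ω ↔ g (key b) ω) := by
      intro b hb
      by_cases hab : a ∈ P b
      · simp only [hkey, if_pos hab]
        rw [hg_a]
        constructor
        · intro h; exact h (Finset.mem_coe.2 hab)
        · intro ha y hy
          have hy' := Finset.mem_coe.1 hy
          by_cases hya : y = a
          · rw [hya]; exact ha
          · apply hTω'
            by_cases hyPa : y ∈ P a
            · exact hchain y hyPa hya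
            · exact hglue b hb hab y hy' hyPa
      · by_cases hne : (G b).Nonempty
        · simp only [hkey, if_neg hab, dif_pos hne]
          rw [hg_G b hb hab hne]
          constructor
          · intro h y hy
            exact h (Finset.mem_coe.2 (hGsub b (Finset.mem_coe.1 hy)))
          · intro h y hy
            have hy' := Finset.mem_coe.1 hy
            by_cases hyG : y ∈ G b
            · exact h (Finset.mem_coe.2 hyG)
            · exact hTω' y (hsure b hb hab y hy' hyG)
        · simp only [hkey, if_neg hab, dif_neg hne]
          have hba : b ≠ a := fun h => hab (h ▸ hrefl a)
          constructor
          · intro _; exact hg_other b hba (hnot_rep b (hqb1 b hb hab hne)) ω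
          · intro _ y hy
            have hy' := Finset.mem_coe.1 hy
            exact hTω' y (hsure b hb hab y hy' (fun h => hne ⟨y, h⟩))
    rw [show (A.filter fun b => ((P b : Finset (Fin m)) : Set (Fin m)) ⊆ ω) = A.filter (fun b => g (key b) ω) from
      Finset.filter_congr fun b hb => hiff b hb]
    have hmaps : ((A.filter fun b => g (key b) ω : Finset (Fin m)) : Set (Fin m)).MapsTo key
        ((Finset.univ : Finset (Fin m)).filter fun k => g k ω) := by
      intro b hb
      have hb' := (Finset.mem_filter.1 (Finset.mem_coe.1 hb)).2
      exact Finset.mem_coe.2 (Finset.mem_filter.2 ⟨Finset.mem_univ _, hb'⟩)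
    rw [Finset.card_eq_sum_card_fiberwise hmaps]
    push_cast
    refine Finset.sum_congr rfl fun k hk => ?_
    have hgk : g k ω := (Finset.mem_filter.1 hk).2
    simp only [hc]
    congr 2
    ext b
    simp only [Finset.mem_filter]
    constructor
    · rintro ⟨⟨hb, _⟩, hk⟩; exact ⟨hb, hk⟩
    · rintro ⟨hb, hk⟩; exact ⟨⟨hb, hk ▸ hgk⟩, hk⟩
  have hevents : {ω : Set (Fin m) | ω ∪ ↑T ∈ L} = {ω : Set (Fin m) | ω ∪ ↑T ∈ S'} := by
    ext ω
    have hc' := hcount (ω ∪ ↑T) Set.subset_union_right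
    simp only [Set.mem_setOf_eq, hL, hS']
    rw [← Nat.cast_le (α := ℝ), hc']
  calc μ.real L = μ.real {ω : Set (Fin m) | ω ∪ ↑T ∈ L} := by
          rw [hμ]; exact prodBernoulli_real_eq_union_of_gate_one q T hT1 L
    _ = μ.real {ω : Set (Fin m) | ω ∪ ↑T ∈ S'} := by rw [hevents]
    _ = μ.real S' := by rw [hμ]; exact (prodBernoulli_real_eq_union_of_gate_one q T hT1 _).symm
    _ = (prodBernoulli q').real S := hpre
    _ ≤ 1 - ((q' a : unitInterval) : ℝ) := hfar
    _ = 1 - (q a : ℝ) := by rw [hq'a]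

/-- **Induction over the chain** (on the number `n` of non-sure strict members of `P a`): the block-comb hypotheses and the mean hypothesis give
`P(#{b ∈ A | P b open} ≤ j) ≤ 1 − ∏_{P a} q`.  Step: a non-sure `e ∈ P a ∖ {a}` with `q e = 0` makes the bound `1`; otherwise
`Quant.farTree_light_le_of_contract` reduces to `q[e ↦ 1]`, where every hypothesis persists (the essential private parts are unchanged). [this work] -/
theorem farTree_blockComb_cell_aux (P : Fin m → Finset (Fin m)) (hrefl : ∀ x, x ∈ P x)
    (A : Finset (Fin m)) (j : ℕ) (a : Fin m) (haA : a ∈ A) :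
    ∀ (n : ℕ) (q : Fin m → unitInterval),
      (((P a).erase a).filter fun y => q y ≠ 1).card = n →
      (∀ b ∈ A, a ∈ P b → ∀ y ∈ P b, y ∉ P a → q y = 1) →
      (∀ b ∈ A, ∀ b' ∈ A, a ∉ P b → a ∉ P b' →
        (P b \ P a).filter (fun y => q y ≠ 1) = (P b' \ P a).filter (fun y => q y ≠ 1) ∨
          Disjoint ((P b \ P a).filter fun y => q y ≠ 1) ((P b' \ P a).filter fun y => q y ≠ 1)) →
      (∀ b ∈ A, a ∉ P b → (q a : ℝ) ≤ ∏ y ∈ P b \ P a, (q y : ℝ)) →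
      (2 * j : ℝ) < ∑ b ∈ A, ∏ y ∈ P b, (q y : ℝ) →
      (prodBernoulli q).real
          {ω : Set (Fin m) | (A.filter fun b => ((P b : Finset (Fin m)) : Set (Fin m)) ⊆ ω).card ≤ j} ≤
        1 - ∏ y ∈ P a, (q y : ℝ) := by
  intro n
  induction n with
  | zero =>
    intro q hn hglue hshape hbare hEN
    have hchain : ∀ y ∈ P a, y ≠ a → q y = 1 := by
      intro y hy hya
      by_contra hq
      have : y ∈ ((P a).erase a).filter fun y => q y ≠ 1 := Finset.mem_filter.2 ⟨Finset.mem_erase.2 ⟨hya, hy⟩, hq⟩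
      rw [Finset.card_eq_zero.1 hn] at this
      exact Finset.notMem_empty _ this
    have hprod : ∏ y ∈ P a, (q y : ℝ) = q a := by
      rw [← Finset.mul_prod_erase _ _ (hrefl a)]
      rw [Finset.prod_eq_one fun y hy => by
        rw [hchain y (Finset.mem_of_mem_erase hy) (Finset.ne_of_mem_erase hy)]; rfl]
      exact mul_one _
    rw [hprod]
    exact farTree_blockComb_cell_base P hrefl q A j a haA hchain hglue hshape hbare hEN
  | succ n ih =>
    intro q hn hglue hshape hbare hEN
    have hne : (((P a).erase a).filter fun y => q y ≠ 1).Nonempty := by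
      rw [← Finset.card_pos, hn]; exact Nat.succ_pos n
    obtain ⟨e, he⟩ := hne
    have heP : e ∈ P a := Finset.mem_of_mem_erase (Finset.mem_filter.1 he).1
    have hea : e ≠ a := Finset.ne_of_mem_erase (Finset.mem_filter.1 he).1
    by_cases hqe0 : (q e : ℝ) = 0
    · have hprod : ∏ y ∈ P a, (q y : ℝ) = 0 := Finset.prod_eq_zero heP hqe0
      rw [hprod, sub_zero]
      exact measureReal_le_one
    set q' : Fin m → unitInterval := Function.update q e 1 with hq'
    have hq'e : q' e = 1 := by simp [hq']
    have hq'ne : ∀ y, y ≠ e → q' y = q y := fun y hy => by simp [hq', Function.update_of_ne hy]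
    have hn' : (((P a).erase a).filter fun y => q' y ≠ 1).card = n := by
      have hset : (((P a).erase a).filter fun y => q' y ≠ 1) = (((P a).erase a).filter fun y => q y ≠ 1).erase e := by
        ext y
        simp only [Finset.mem_filter, Finset.mem_erase]
        constructor
        · rintro ⟨hy, hq⟩
          have hye : y ≠ e := fun h => hq (h ▸ hq'e)
          exact ⟨hye, hy, by rwa [hq'ne y hye] at hq⟩
        · rintro ⟨hye, hy, hq⟩
          exact ⟨hy, by rwa [hq'ne y hye]⟩
      rw [hset, Finset.card_erase_of_mem he, hn]
      rfl
    have hE : ∀ b, (P b \ P a).filter (fun y => q' y ≠ 1) = (P b \ P a).filter (fun y => q y ≠ 1) := by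
      intro b
      refine Finset.filter_congr fun y hy => ?_
      rw [hq'ne y (fun h => (Finset.mem_sdiff.1 hy).2 (h ▸ heP))]
    have hglue' : ∀ b ∈ A, a ∈ P b → ∀ y ∈ P b, y ∉ P a → q' y = 1 := by
      intro b hb hab y hy hyPa
      have hye : y ≠ e := fun h => hyPa (h ▸ heP)
      rw [hq'ne y hye]
      exact hglue b hb hab y hy hyPa
    have hshape' : ∀ b ∈ A, ∀ b' ∈ A, a ∉ P b → a ∉ P b' →
        (P b \ P a).filter (fun y => q' y ≠ 1) = (P b' \ P a).filter (fun y => q' y ≠ 1) ∨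
          Disjoint ((P b \ P a).filter fun y => q' y ≠ 1) ((P b' \ P a).filter fun y => q' y ≠ 1) := by
      intro b hb b' hb' hab hab'
      rw [hE b, hE b']
      exact hshape b hb b' hb' hab hab'
    have hbare' : ∀ b ∈ A, a ∉ P b → (q' a : ℝ) ≤ ∏ y ∈ P b \ P a, (q' y : ℝ) := by
      intro b hb hab
      rw [hq'ne a hea.symm]
      have : ∏ y ∈ P b \ P a, (q' y : ℝ) = ∏ y ∈ P b \ P a, (q y : ℝ) :=
        Finset.prod_congr rfl fun y hy => by
          rw [hq'ne y (fun h => (Finset.mem_sdiff.1 hy).2 (h ▸ heP))]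
      rw [this]
      exact hbare b hb hab
    have hEN' : (2 * j : ℝ) < ∑ b ∈ A, ∏ y ∈ P b, (q' y : ℝ) :=
      lt_of_lt_of_le hEN (Finset.sum_le_sum fun b _ => prod_le_prod_update_one q e (P b))
    have hih := ih q' hn' hglue' hshape' hbare' hEN'
    have hkey := prod_update_one_eq q e (P a)
    rw [if_pos heP] at hkey
    have hdiv : ∏ y ∈ P a, (q' y : ℝ) = (∏ y ∈ P a, (q y : ℝ)) / (q e : ℝ) := by
      rw [eq_div_iff hqe0, hq']
      exact hkey
    rw [hdiv] at hih
    exact farTree_light_le_of_contract P q A j (∏ y ∈ P a, (q y : ℝ)) e hqe0 hih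

/-- **FAR at EVERY layer for block-combs in the bare-leaf cell, essential form** (gate coordinates of `Quant.FarTreeRow`): gate sets
`P x ∋ x` on `Fin m`, gates `q`, relays `A ∋ a`, layer `j`; (glue) relays `b` with `a ∈ P b` have `P b ∖ P a` sure; (block-comb) for
`b, b'` with `a ∉ P b, P b'` the ESSENTIAL private parts `{y ∈ P b ∖ P a | q y ≠ 1}` are equal or disjoint (so glued blocks may be paths
of weight-one edges and may share sure vertices — the shape delivered by `Quant.tree_ancestor_axioms`); (bare leaf) `q a ≤ ∏_{P b ∖ P a} q`
whenever `a ∉ P b`.  Then `2j < Σ_{b∈A} ∏_{P b} q` and `1 − ∏_{P a} q ≤ t` give `P(#{b ∈ A | P b open} ≤ j) ≤ t`.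
Strictly contains `Quant.farTree_blockComb_bareLeaf` (equal-or-disjoint private parts).
builds on p205010 (kernel theorem, internal audit signed; external expert review pending). [this work] -/
theorem farTree_blockComb_cell (P : Fin m → Finset (Fin m)) (hrefl : ∀ x, x ∈ P x)
    (q : Fin m → unitInterval) (A : Finset (Fin m)) (j : ℕ) (t : ℝ) (a : Fin m) (haA : a ∈ A)
    (hglue : ∀ b ∈ A, a ∈ P b → ∀ y ∈ P b, y ∉ P a → q y = 1)
    (hshape : ∀ b ∈ A, ∀ b' ∈ A, a ∉ P b → a ∉ P b' →
      (P b \ P a).filter (fun y => q y ≠ 1) = (P b' \ P a).filter (fun y => q y ≠ 1) ∨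
        Disjoint ((P b \ P a).filter fun y => q y ≠ 1) ((P b' \ P a).filter fun y => q y ≠ 1))
    (hbare : ∀ b ∈ A, a ∉ P b → (q a : ℝ) ≤ ∏ y ∈ P b \ P a, (q y : ℝ))
    (hEN : (2 * j : ℝ) < ∑ b ∈ A, ∏ y ∈ P b, (q y : ℝ))
    (ht : 1 - ∏ y ∈ P a, (q y : ℝ) ≤ t) :
    (prodBernoulli q).real
        {ω : Set (Fin m) | (A.filter fun b => ((P b : Finset (Fin m)) : Set (Fin m)) ⊆ ω).card ≤ j} ≤ t :=
  le_trans (farTree_blockComb_cell_aux P hrefl A j a haA _ q rfl hglue hshape hbare hEN) ht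

end Quant
end Summit.CriticalPhenomena.PercolationContinuityZ3.Theorems
end
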